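import Literature.Computability.MetaComplexity.XorPHPLowerBound
import Literature.Computability.MetaComplexity.TseitinDepthFregeSubdivision
import HarnessLib

/-!
# A bounded-depth Frege lower bound for Tseitin formulas on grids (weak exponent, all charges)

For the Tseitin system `gridSystem k f` of the grid `𝓗_{k,k}` with ARBITRARY charges `f`
(`TseitinDepthFregeBricks.lean`: rows = the cells `(i, c) ∈ [0,k]²`, variables = the grid edges,
horizontal `(i,c)—(i,c+1)` and vertical `(i,c)—(i+1,c)`), every depth-`d` `textbookFrege`-proof of
the negated parity CNF `¬ ⋀ sumEncoding 1 (gridSystem k f)` has size at least `2^{k^{ε_d}}` for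
`k ≥ k₀(d)` (`gridSystem_depthFrege_lowerBound`). This is Håstad's grid theorem (J. ACM 2020,
Thm. 6.2: `2^{k^{Ω(1/d)}}`) with the weak exponent `ε_d` of the tree's Ajtai theorem, obtained —
with NO unproved hypothesis — by Ben-Sasson's reduction of the bijective pigeonhole principle
(`OntoPHPReduction.depthFrege_lowerBound_of_sound_label`, `XorPHPLowerBound.lean`): it is the
hypothesis (H′) of `galesiEtAl_tseitin_treewidth_depthFrege_lowerBound_of_grid_of_wall`
(`TseitinDepthFregeProofs.lean`) with `ε_d` in place of `c/d`.

The sound labelling (`GridLabel.lab`) with `N = k` holes: row `i ∈ [0,k]` is the walk of pigeon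
`i` (left to right), column `c ∈ [1,k]` the walk of hole `c - 1` (top to bottom); the horizontal
edge `(i,c)—(i,c+1)` carries the pigeon-star `(i, {c,…,k-1})` ("the hole of pigeon `i` lies in a
column `> c`"), the vertical edge `(i,c)—(i+1,c)`, `c ≠ 0`, the hole-star `(c-1, {i+1,…,k})`. Under a
local bijection the stars at a cell telescope to `κ(i,c) = [i = 0 ∨ c = 0]` (pigeon terminals in
column `0`, hole terminals in row `0`, `[f i = c-1] ⊕ [g(c-1) = i] = 0` at the crossings by local
consistency). The charges enter through the CONSTANT bits: an edge set with odd degree exactly at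
the cells where `f + κ = 1` (a `T`-join, routed down the columns and along the last row:
`GridLabel.cbit`), which exists because `Σ f = 1` for an unsatisfiable system while `Σ κ = 2k+1`;
for `Σ f = 0` the same routing solves the system, so no proof of the negation exists.

References: J. Håstad, *On small-depth Frege proofs for Tseitin for grids*, J. ACM 68 (2020),
Thm. 6.2 (statement, exponent `Ω(1/d)`); E. Ben-Sasson, *Hard examples for the bounded depth Frege
proof system*, Comput. Complexity 11 (2002) (the method); J. Krajíček, *Proof complexity*, CUP
2019, §15.4 and p. 431; N. Galesi, D. Itsykson, A. Riazanov, A. Sofronova, APAL 174 (2023) (the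
grid Tseitin system `T(𝓗_{n,n}, f)`, §2).
-/

namespace Literature.Computability.MetaComplexity

open Complexity Complexity.PropForm Finset OntoPHPReduction

namespace GridLabel

/-! ### Boolean values in `𝔽₂` -/

/-- A Boolean as an element of `𝔽₂`. [folklore] -/
def zv (b : Bool) : ZMod 2 := if b then 1 else 0

/-- `zv` of an exclusive or. [folklore] -/
theorem zv_xor (a b : Bool) : zv (a ^^ b) = zv a + zv b := by
  cases a <;> cases b <;> decide

/-- `zv false = 0`. [folklore] -/
@[simp] theorem zv_false : zv false = 0 := rfl

/-- `zv true = 1`. [folklore] -/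
@[simp] theorem zv_true : zv true = 1 := rfl

/-- `zv` of the indicator of `x = 1` is `x`. [folklore] -/
theorem zv_decide_eq_one (x : ZMod 2) : zv (decide (x = 1)) = x := by
  fin_cases x <;> decide

/-- `zv (decide P)` as an `if`. [folklore] -/
theorem zv_decide (P : Prop) [Decidable P] : zv (decide P) = if P then 1 else 0 := by
  by_cases h : P <;> simp [zv, h]

/-! ### The demand and its routing (the constant bits) -/

section Defs

variable (k : ℕ) (f : Fin (k + 1) × Fin (k + 1) → ZMod 2)

/-- `κ`: the charge produced by the stars alone — `1` on row `0` and on column `0`. [folklore] -/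
def kap (w : Fin (k + 1) × Fin (k + 1)) : ZMod 2 := if w.1 = 0 ∨ w.2 = 0 then 1 else 0

/-- The demand of the constant bits: `f + κ`. [folklore] -/
def dem (w : Fin (k + 1) × Fin (k + 1)) : ZMod 2 := f w + kap k w

variable (dm : Fin (k + 1) × Fin (k + 1) → ZMod 2)

/-- A demand function extended by `0` outside the grid (indices in `ℕ`). [folklore] -/
def demN (i c : ℕ) : ZMod 2 :=
  if h : i < k + 1 ∧ c < k + 1 then dm (⟨i, h.1⟩, ⟨c, h.2⟩) else 0

/-- Column prefix sums of a demand: `Σ_{i' ≤ t} dm (i', c)`. [folklore] -/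
def colPre (t c : ℕ) : ZMod 2 := ∑ x ∈ range (t + 1), demN k dm x c

/-- Prefix sums along the last row of the column totals: `Σ_{c' ≤ t} Σ_{i'} dm (i', c')`.
[folklore] -/
def rowPre (t : ℕ) : ZMod 2 := ∑ y ∈ range (t + 1), colPre k dm k y

/-- **The routing of a demand** (a `T`-join when the total demand vanishes): the vertical edge
`(i,c)—(i+1,c)` carries the column prefix sum down to row `i`, the horizontal edge `(k,c)—(k,c+1)`
of the last row the prefix sum of the column totals, other horizontal edges `0`. [folklore] -/
def cbit : GridEdge k → ZMod 2
  | Sum.inl (i, c) => if (i : ℕ) = k then rowPre k dm c else 0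
  | Sum.inr (i, c) => colPre k dm i c

/-- The pigeon-star of an edge: the horizontal edge `(i,c)—(i,c+1)` carries `(i, {c,…,k-1})`.
[cite: KrajicekProofComplexity2019, §15.4 (the substitution of a reduction to ontoPHP)] -/
def psOf : GridEdge k → Option (ℕ × Finset ℕ)
  | Sum.inl (i, c) => some ((i : ℕ), Finset.Ico (c : ℕ) k)
  | Sum.inr _ => none

/-- The hole-star of an edge: the vertical edge `(i,c)—(i+1,c)`, `c ≠ 0`, carries
`(c-1, {i+1,…,k})`. [cite: KrajicekProofComplexity2019, §15.4 (the substitution of a reduction to ontoPHP)] -/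
def hsOf : GridEdge k → Option (ℕ × Finset ℕ)
  | Sum.inl _ => none
  | Sum.inr (i, c) => if (c : ℕ) = 0 then none else some ((c : ℕ) - 1, Finset.Ico ((i : ℕ) + 1) (k + 1))

/-- Decoding a variable index of `gridSystem k f` into a grid edge. [folklore] -/
noncomputable def dec (j : ℕ) (h : j < Fintype.card (GridEdge k)) : GridEdge k :=
  (Fintype.equivFin (GridEdge k)).symm ⟨j, h⟩

/-- **The labelling of the grid Tseitin system** `gridSystem k f`. [cite: KrajicekProofComplexity2019, §15.4 (the substitution of a reduction to ontoPHP)] -/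
noncomputable def lab : PHPLabel where
  c := fun j => if h : j < Fintype.card (GridEdge k) then decide (cbit k (dem k f) (dec k j h) = 1) else false
  ps := fun j => if h : j < Fintype.card (GridEdge k) then psOf k (dec k j h) else none
  hs := fun j => if h : j < Fintype.card (GridEdge k) then hsOf k (dec k j h) else none

end Defs

variable {k : ℕ} {f : Fin (k + 1) × Fin (k + 1) → ZMod 2}

/-! ### Decoding -/

/-- `gi k ε` is a variable index. [folklore] -/
theorem gi_lt (ε : GridEdge k) : gi k ε < Fintype.card (GridEdge k) := (Fintype.equivFin _ ε).isLt

/-- Decoding the index of an edge gives the edge. [folklore] -/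
theorem dec_gi (ε : GridEdge k) (h : gi k ε < Fintype.card (GridEdge k)) : dec k (gi k ε) h = ε := by
  unfold dec gi
  rw [Fin.eta, Equiv.symm_apply_apply]

/-- The constant bit of an edge. [folklore] -/
theorem c_gi (ε : GridEdge k) : (lab k f).c (gi k ε) = decide (cbit k (dem k f) ε = 1) := by
  simp only [lab, dif_pos (gi_lt ε), dec_gi]

/-- The pigeon-star of an edge. [folklore] -/
theorem ps_gi (ε : GridEdge k) : (lab k f).ps (gi k ε) = psOf k ε := by
  simp only [lab, dif_pos (gi_lt ε), dec_gi]

/-- The hole-star of an edge. [folklore] -/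
theorem hs_gi (ε : GridEdge k) : (lab k f).hs (gi k ε) = hsOf k ε := by
  simp only [lab, dif_pos (gi_lt ε), dec_gi]

/-! ### Well-formedness -/

/-- **The labelling is well formed** (with `N = k` holes). [folklore] -/
theorem lab_wf : (lab k f).WF k := by
  constructor
  · intro v b J h
    simp only [lab] at h
    split_ifs at h with h1
    rcases hε : dec k v h1 with ⟨i, c⟩ | ⟨i, c⟩
    · rw [hε, psOf] at h
      obtain ⟨rfl, rfl⟩ := Prod.mk.inj (Option.some.inj h)
      exact ⟨i.isLt, fun a ha => (Finset.mem_Ico.1 ha).2⟩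
    · rw [hε, psOf] at h
      exact absurd h (by simp)
  · intro v a I h
    simp only [lab] at h
    split_ifs at h with h1
    rcases hε : dec k v h1 with ⟨i, c⟩ | ⟨i, c⟩
    · rw [hε, hsOf] at h
      exact absurd h (by simp)
    · rw [hε, hsOf] at h
      split_ifs at h with hc
      obtain ⟨rfl, rfl⟩ := Prod.mk.inj (Option.some.inj h)
      have := c.isLt
      exact ⟨by omega, fun b hb => (Finset.mem_Ico.1 hb).2⟩

/-! ### Values of the edges under a local bijection, in `𝔽₂` -/

/-- Value of a horizontal edge: constant bit plus pigeon-star. [folklore] -/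
theorem zv_val_inl (fP gH : ℕ → ℕ) (i : Fin (k + 1)) (c : Fin k) :
    zv (val (lab k f) fP gH (gi k (Sum.inl (i, c)))) =
      cbit k (dem k f) (Sum.inl (i, c)) + (if (c : ℕ) ≤ fP i ∧ fP i < k then 1 else 0) := by
  rw [OntoPHPReduction.val, zv_xor, zv_xor, pval, hval, ps_gi, hs_gi, c_gi, zv_decide_eq_one]
  simp only [psOf, hsOf, zv_false, add_zero, zv_decide, Finset.mem_Ico]

/-- Value of a vertical edge: constant bit plus hole-star (none in column `0`). [folklore] -/
theorem zv_val_inr (fP gH : ℕ → ℕ) (i : Fin k) (c : Fin (k + 1)) :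
    zv (val (lab k f) fP gH (gi k (Sum.inr (i, c)))) =
      cbit k (dem k f) (Sum.inr (i, c)) +
        (if (c : ℕ) ≠ 0 ∧ ((i : ℕ) + 1 ≤ gH ((c : ℕ) - 1) ∧ gH ((c : ℕ) - 1) < k + 1) then 1 else 0) := by
  rw [OntoPHPReduction.val, zv_xor, zv_xor, pval, hval, ps_gi, hs_gi, c_gi, zv_decide_eq_one]
  simp only [psOf, hsOf, zv_false, add_zero]
  by_cases hc : (c : ℕ) = 0
  · simp [hc]
  · simp only [hc, if_false, zv_decide, Finset.mem_Ico, ne_eq, not_false_eq_true, true_and]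

/-! ### The grid Tseitin system: coefficients, rows, supports -/

/-- The coefficient of the variable of the grid edge `ε` in the row of the cell `w`: the number of
ends of `ε` equal to `w` (restated here from `TseitinDepthFregeProofs` to keep the imports light).
[cite: GalesiEtAl2023, §2 (Tseitin formulas; grids)] -/
theorem coeff_gridSystem (w : Fin (k + 1) × Fin (k + 1)) (ε : GridEdge k) :
    (gridSystem k f (Fintype.equivFin _ w)).1 (Fintype.equivFin _ ε) =
      (if (gridEnds ε).1 = w then 1 else 0) + (if (gridEnds ε).2 = w then 1 else 0) := by
  simp only [gridSystem, Equiv.symm_apply_apply]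
  have hne := gridEnds_fst_ne_snd ε
  by_cases h1 : (gridEnds ε).1 = w <;> by_cases h2 : (gridEnds ε).2 = w
  · exact absurd (h1.trans h2.symm) hne
  · rw [if_pos (Or.inl h1.symm), if_pos h1, if_neg h2, add_zero]
  · rw [if_pos (Or.inr h2.symm), if_neg h1, if_pos h2, zero_add]
  · rw [if_neg, if_neg h1, if_neg h2, add_zero]
    rintro (h | h)
    · exact h1 h.symm
    · exact h2 h.symm

/-- The left-hand side of the row of the cell `w` under values `z`: the sum over the edges
entering the left copy plus the sum over the edges entering the right copy of `w`. [folklore] -/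
theorem rowSum_gridSystem (w : Fin (k + 1) × Fin (k + 1)) (z : Fin (Fintype.card (GridEdge k)) → ZMod 2) :
    ∑ j, (gridSystem k f (Fintype.equivFin _ w)).1 j * z j =
      ∑ ε ∈ leftEdges w, z (Fintype.equivFin _ ε) + ∑ ε ∈ rightEdges w, z (Fintype.equivFin _ ε) := by
  rw [← Equiv.sum_comp (Fintype.equivFin (GridEdge k))]
  simp only [coeff_gridSystem, add_mul, ite_mul, one_mul, zero_mul, Finset.sum_add_distrib]
  rw [leftEdges, rightEdges, Finset.sum_filter, Finset.sum_filter]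

/-- A variable in the support of the row of `w` is the index of an edge with an end at `w`.
[folklore] -/
theorem exists_of_mem_supp {w : Fin (k + 1) × Fin (k + 1)} {j : Fin (Fintype.card (GridEdge k))}
    (hj : j ∈ (gridSystem k f (Fintype.equivFin _ w)).supp) :
    ∃ ε : GridEdge k, j = Fintype.equivFin _ ε ∧ ((gridEnds ε).1 = w ∨ (gridEnds ε).2 = w) := by
  obtain ⟨ε, rfl⟩ : ∃ ε, j = Fintype.equivFin _ ε := ⟨(Fintype.equivFin _).symm j, by simp⟩
  refine ⟨ε, rfl, ?_⟩
  have hcoef := (Finset.mem_filter.1 hj).2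
  rw [coeff_gridSystem] at hcoef
  by_contra h
  rw [not_or] at h
  exact hcoef (by rw [if_neg h.1, if_neg h.2, add_zero])

/-- An edge with an end at `w` is a variable of the row of `w`. [folklore] -/
theorem gi_mem_eqVars {w : Fin (k + 1) × Fin (k + 1)} {ε : GridEdge k}
    (h : (gridEnds ε).1 = w ∨ (gridEnds ε).2 = w) :
    gi k ε ∈ eqVars 1 (gridSystem k f (Fintype.equivFin _ w)) := by
  rw [mem_eqVars]
  refine ⟨Fintype.equivFin _ ε, ?_, ?_⟩
  · rw [LinEqMod.supp, Finset.mem_filter, coeff_gridSystem]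
    refine ⟨Finset.mem_univ _, ?_⟩
    have hne := gridEnds_fst_ne_snd ε
    rcases h with h | h
    · rw [if_pos h, if_neg (fun h' => hne (h.trans h'.symm)), add_zero]; exact one_ne_zero
    · rw [if_neg (fun h' => hne (h'.trans h.symm)), if_pos h, zero_add]; exact one_ne_zero
  · rw [mem_encBlock]
    exact ⟨0, by omega, by simp [gi]⟩

/-- The support of a grid row has at most four variables. [cite: GalesiEtAl2023, Lemma 16 ("all
degrees in M_n are at most 4")] -/
theorem card_supp_gridSystem_le (i : Fin (Fintype.card (Fin (k + 1) × Fin (k + 1)))) :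
    (gridSystem k f i).supp.card ≤ 4 := by
  classical
  obtain ⟨w, rfl⟩ : ∃ w, i = Fintype.equivFin _ w := ⟨(Fintype.equivFin _).symm i, by simp⟩
  have hsub : (gridSystem k f (Fintype.equivFin _ w)).supp ⊆
      (leftEdges w ∪ rightEdges w).map (Fintype.equivFin (GridEdge k)).toEmbedding := by
    intro j hj
    obtain ⟨ε, rfl, hε⟩ := exists_of_mem_supp hj
    rw [Finset.mem_map]
    refine ⟨ε, ?_, rfl⟩
    rw [Finset.mem_union, leftEdges, rightEdges, Finset.mem_filter, Finset.mem_filter]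
    rcases hε with h | h
    · exact Or.inl ⟨Finset.mem_univ _, h⟩
    · exact Or.inr ⟨Finset.mem_univ _, h⟩
  calc _ ≤ ((leftEdges w ∪ rightEdges w).map (Fintype.equivFin (GridEdge k)).toEmbedding).card :=
        Finset.card_le_card hsub
    _ ≤ (leftEdges w).card + (rightEdges w).card := by
        rw [Finset.card_map]; exact Finset.card_union_le _ _
    _ ≤ 4 := by
        have h₁ := card_leftEdges_le w
        have h₂ : (rightEdges w).card ≤ 2 := by
          have hinj : Set.InjOn (fun ε : GridEdge k => ε.isLeft) ↑(rightEdges w) := by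
            rintro (⟨i, c⟩ | ⟨i, c⟩) hε (⟨i', c'⟩ | ⟨i', c'⟩) hε' heq <;>
              simp only [rightEdges, Finset.coe_filter, Set.mem_setOf_eq, Finset.mem_univ, true_and,
                gridEnds_inl, gridEnds_inr, Sum.isLeft_inl, Sum.isLeft_inr, Bool.false_eq_true,
                Bool.true_eq_false] at hε hε' heq
            · rw [← hε'] at hε
              simp only [Prod.mk.injEq] at hε
              rw [hε.1, Fin.castSucc_inj.1 hε.2]
            · rw [← hε'] at hε
              simp only [Prod.mk.injEq] at hε
              rw [Fin.succ_inj.1 hε.1, hε.2]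
          calc (rightEdges w).card ≤ (Finset.univ : Finset Bool).card :=
                Finset.card_le_card_of_injOn _ (fun _ _ => Finset.mem_univ _) hinj
            _ = 2 := rfl
        omega

/-! ### The four edges at a cell -/

/-- Extension by zero of a function on horizontal edges to `ℕ × ℕ`. [folklore] -/
def extH {M : Type*} [Zero M] (F : GridEdge k → M) (i c : ℕ) : M :=
  if h : i < k + 1 ∧ c < k then F (Sum.inl (⟨i, h.1⟩, ⟨c, h.2⟩)) else 0

/-- Extension by zero of a function on vertical edges to `ℕ × ℕ`. [folklore] -/
def extV {M : Type*} [Zero M] (F : GridEdge k → M) (i c : ℕ) : M :=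
  if h : i < k ∧ c < k + 1 then F (Sum.inr (⟨i, h.1⟩, ⟨c, h.2⟩)) else 0

/-- The sum over the edges entering the left copy of a cell: the horizontal edge from the left
and the vertical edge going down. [folklore] -/
theorem sum_leftEdges {M : Type*} [AddCommMonoid M] (F : GridEdge k → M) (w : Fin (k + 1) × Fin (k + 1)) :
    ∑ ε ∈ leftEdges w, F ε =
      (if (w.2 : ℕ) = 0 then 0 else extH F w.1 ((w.2 : ℕ) - 1)) + extV F w.1 w.2 := by
  classical
  obtain ⟨i, c⟩ := w
  rw [leftEdges, Finset.sum_filter, Fintype.sum_sum_type]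
  congr 1
  · -- horizontal edges `(i', c')` with `(i', c'+1) = (i, c)`
    by_cases hc : (c : ℕ) = 0
    · rw [if_pos hc]
      refine Finset.sum_eq_zero fun x _ => ?_
      rw [if_neg]
      rintro h
      rw [gridEnds_inl] at h
      have := congrArg (fun p => (p.2 : ℕ)) h
      simp at this
      omega
    · rw [if_neg hc]
      have hc1 : (c : ℕ) - 1 < k := by have := c.isLt; omega
      rw [Finset.sum_eq_single (i, ⟨(c : ℕ) - 1, hc1⟩)]
      · rw [if_pos, extH, dif_pos ⟨i.isLt, hc1⟩]
        rw [gridEnds_inl]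
        ext <;> simp
        omega
      · rintro ⟨i', c'⟩ - hne
        rw [if_neg]
        intro h
        rw [gridEnds_inl] at h
        apply hne
        have h1 := congrArg Prod.fst h
        have h2 := congrArg (fun p => (p.2 : ℕ)) h
        simp at h1 h2
        ext
        · simpa using congrArg Fin.val h1
        · simp; omega
      · simp
  · -- vertical edges `(i', c')` with `(i', c') = (i, c)`, `i' < k`
    by_cases hi : (i : ℕ) < k
    · rw [extV, dif_pos ⟨hi, c.isLt⟩]
      rw [Finset.sum_eq_single (⟨i, hi⟩, c)]
      · rw [if_pos]
        rw [gridEnds_inr]; ext <;> simp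
      · rintro ⟨i', c'⟩ - hne
        rw [if_neg]
        intro h
        rw [gridEnds_inr] at h
        apply hne
        have h1 := congrArg (fun p => (p.1 : ℕ)) h
        have h2 := congrArg Prod.snd h
        simp at h1 h2
        ext
        · simp; omega
        · simpa using congrArg Fin.val h2
      · simp
    · rw [extV, dif_neg (fun h => hi h.1)]
      refine Finset.sum_eq_zero fun x _ => ?_
      rw [if_neg]
      intro h
      rw [gridEnds_inr] at h
      have := congrArg (fun p => (p.1 : ℕ)) h
      simp at this
      have := x.1.isLt
      omega

/-- The sum over the edges entering the right copy of a cell: the horizontal edge to the right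
and the vertical edge from above. [folklore] -/
theorem sum_rightEdges {M : Type*} [AddCommMonoid M] (F : GridEdge k → M) (w : Fin (k + 1) × Fin (k + 1)) :
    ∑ ε ∈ rightEdges w, F ε =
      extH F w.1 w.2 + (if (w.1 : ℕ) = 0 then 0 else extV F ((w.1 : ℕ) - 1) w.2) := by
  classical
  obtain ⟨i, c⟩ := w
  rw [rightEdges, Finset.sum_filter, Fintype.sum_sum_type]
  congr 1
  · -- horizontal edges `(i', c')` with `(i', c') = (i, c)`, `c' < k`
    by_cases hc : (c : ℕ) < k
    · rw [extH, dif_pos ⟨i.isLt, hc⟩]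
      rw [Finset.sum_eq_single (i, ⟨c, hc⟩)]
      · rw [if_pos]
        rw [gridEnds_inl]; ext <;> simp
      · rintro ⟨i', c'⟩ - hne
        rw [if_neg]
        intro h
        rw [gridEnds_inl] at h
        apply hne
        have h1 := congrArg Prod.fst h
        have h2 := congrArg (fun p => (p.2 : ℕ)) h
        simp at h1 h2
        ext
        · simpa using congrArg Fin.val h1
        · simp; omega
      · simp
    · rw [extH, dif_neg (fun h => hc h.2)]
      refine Finset.sum_eq_zero fun x _ => ?_
      rw [if_neg]
      intro h
      rw [gridEnds_inl] at h
      have := congrArg (fun p => (p.2 : ℕ)) h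
      simp at this
      have := x.2.isLt
      omega
  · -- vertical edges `(i', c')` with `(i'+1, c') = (i, c)`
    by_cases hi : (i : ℕ) = 0
    · rw [if_pos hi]
      refine Finset.sum_eq_zero fun x _ => ?_
      rw [if_neg]
      intro h
      rw [gridEnds_inr] at h
      have := congrArg (fun p => (p.1 : ℕ)) h
      simp at this
      omega
    · rw [if_neg hi]
      have hi1 : (i : ℕ) - 1 < k := by have := i.isLt; omega
      rw [extV, dif_pos ⟨hi1, c.isLt⟩]
      rw [Finset.sum_eq_single (⟨(i : ℕ) - 1, hi1⟩, c)]
      · rw [if_pos]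
        rw [gridEnds_inr]
        ext <;> simp
        omega
      · rintro ⟨i', c'⟩ - hne
        rw [if_neg]
        intro h
        rw [gridEnds_inr] at h
        apply hne
        have h1 := congrArg (fun p => (p.1 : ℕ)) h
        have h2 := congrArg Prod.snd h
        simp at h1 h2
        ext
        · simp; omega
        · simpa using congrArg Fin.val h2
      · simp

/-! ### The routing of a demand is a `T`-join -/

section TJoin

variable (k) (dm : Fin (k + 1) × Fin (k + 1) → ZMod 2)

/-- Column prefix sums telescope. [folklore] -/
theorem colPre_succ (t c : ℕ) : colPre k dm (t + 1) c = colPre k dm t c + demN k dm (t + 1) c := by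
  rw [colPre, colPre, Finset.sum_range_succ]

/-- The first column prefix sum. [folklore] -/
theorem colPre_zero (c : ℕ) : colPre k dm 0 c = demN k dm 0 c := by
  simp [colPre]

/-- Row prefix sums telescope. [folklore] -/
theorem rowPre_succ (t : ℕ) : rowPre k dm (t + 1) = rowPre k dm t + colPre k dm k (t + 1) := by
  rw [rowPre, rowPre, Finset.sum_range_succ]

/-- The first row prefix sum. [folklore] -/
theorem rowPre_zero : rowPre k dm 0 = colPre k dm k 0 := by
  simp [rowPre]

/-- The last row prefix sum is the total demand. [folklore] -/
theorem rowPre_eq_sum : rowPre k dm k = ∑ w, dm w := by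
  have h1 : rowPre k dm k = ∑ y : Fin (k + 1), ∑ x : Fin (k + 1), demN k dm x y := by
    rw [rowPre, ← Fin.sum_univ_eq_sum_range (fun y => colPre k dm k y) (k + 1)]
    refine Finset.sum_congr rfl fun y _ => ?_
    rw [colPre, ← Fin.sum_univ_eq_sum_range (fun x => demN k dm x y) (k + 1)]
  rw [h1, Fintype.sum_prod_type, Finset.sum_comm]
  refine Finset.sum_congr rfl fun a _ => Finset.sum_congr rfl fun b _ => ?_
  rw [demN, dif_pos ⟨a.isLt, b.isLt⟩]

variable {k dm}

/-- Constant bit of a horizontal edge, through the extension by zero. [folklore] -/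
theorem extH_cbit {i c : ℕ} (hi : i < k + 1) (hc : c < k) :
    extH (cbit k dm) i c = if i = k then rowPre k dm c else 0 := by
  rw [extH, dif_pos ⟨hi, hc⟩]
  rfl

/-- No horizontal edge leaves column `k`. [folklore] -/
theorem extH_of_le {M : Type*} [Zero M] (F : GridEdge k → M) {i c : ℕ} (hc : k ≤ c) : extH F i c = 0 := by
  rw [extH, dif_neg]
  exact fun h => absurd h.2 (by omega)

/-- Constant bit of a vertical edge, through the extension by zero. [folklore] -/
theorem extV_cbit {i c : ℕ} (hi : i < k) (hc : c < k + 1) :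
    extV (cbit k dm) i c = colPre k dm i c := by
  rw [extV, dif_pos ⟨hi, hc⟩]
  rfl

/-- No vertical edge leaves row `k`. [folklore] -/
theorem extV_of_le {M : Type*} [Zero M] (F : GridEdge k → M) {i c : ℕ} (hi : k ≤ i) : extV F i c = 0 := by
  rw [extV, dif_neg]
  exact fun h => absurd h.1 (by omega)

/-- **Horizontal routing at a cell**: the constant bits of the (at most two) horizontal edges at
`(i, c)` sum to the column total in the last row and to `0` elsewhere (total demand `0`).
[folklore] -/
theorem cbit_horizontal (hk : 1 ≤ k) (htot : rowPre k dm k = 0) {i c : ℕ} (hi : i < k + 1) (hc : c < k + 1) :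
    (if c = 0 then 0 else extH (cbit k dm) i (c - 1)) + extH (cbit k dm) i c =
      if i = k then colPre k dm k c else 0 := by
  by_cases hik : i = k
  · rw [if_pos hik]
    rcases Nat.eq_zero_or_pos c with rfl | hc0
    · rw [if_pos rfl, zero_add, extH_cbit hi (by omega), if_pos hik, rowPre_zero]
    · rw [if_neg (by omega), extH_cbit hi (by omega), if_pos hik]
      by_cases hck : c < k
      · rw [extH_cbit hi hck, if_pos hik]
        have := rowPre_succ k dm (c - 1)
        rw [show c - 1 + 1 = c by omega] at this
        rw [this, ← add_assoc, CharTwo.add_self_eq_zero, zero_add]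
      · rw [extH_of_le _ (by omega), add_zero]
        have hck' : c = k := by omega
        have := rowPre_succ k dm (c - 1)
        rw [show c - 1 + 1 = c by omega, hck', htot] at this
        rw [hck']
        -- in `𝔽₂`, `a + b = 0` forces `a = b`
        have h' : rowPre k dm (k - 1) + colPre k dm k k + colPre k dm k k = colPre k dm k k := by
          rw [← this, zero_add]
        rwa [add_assoc, CharTwo.add_self_eq_zero, add_zero] at h'
  · rw [if_neg hik]
    have h1 : extH (cbit k dm) i c = 0 := by
      by_cases hck : c < k
      · rw [extH_cbit hi hck, if_neg hik]
      · exact extH_of_le _ (by omega)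
    have h2 : (if c = 0 then 0 else extH (cbit k dm) i (c - 1)) = 0 := by
      by_cases hc0 : c = 0
      · rw [if_pos hc0]
      · rw [if_neg hc0, extH_cbit hi (by omega), if_neg hik]
    rw [h1, h2, add_zero]

/-- **Vertical routing at a cell**: the constant bits of the (at most two) vertical edges at
`(i, c)` sum to the demand, corrected by the column total in the last row. [folklore] -/
theorem cbit_vertical (hk : 1 ≤ k) {i c : ℕ} (hi : i < k + 1) (hc : c < k + 1) :
    extV (cbit k dm) i c + (if i = 0 then 0 else extV (cbit k dm) (i - 1) c) =
      demN k dm i c + if i = k then colPre k dm k c else 0 := by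
  by_cases hik : i = k
  · rw [if_pos hik, extV_of_le _ (by omega), zero_add, if_neg (by omega), extV_cbit (by omega) hc]
    have := colPre_succ k dm (i - 1) c
    rw [show i - 1 + 1 = i by omega] at this
    rw [hik] at this ⊢
    rw [this, add_comm (colPre k dm (k - 1) c), ← add_assoc, CharTwo.add_self_eq_zero, zero_add]
  · rw [if_neg hik, add_zero, extV_cbit (by omega) hc]
    rcases Nat.eq_zero_or_pos i with rfl | hi0
    · rw [if_pos rfl, add_zero, colPre_zero]
    · rw [if_neg (by omega), extV_cbit (by omega) hc]
      have := colPre_succ k dm (i - 1) c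
      rw [show i - 1 + 1 = i by omega] at this
      rw [this, add_comm (colPre k dm (i - 1) c), add_assoc, CharTwo.add_self_eq_zero, add_zero]

/-- **The routing is a `T`-join of the demand**: at every cell, the constant bits of the incident
edges sum to the demand, provided the total demand vanishes. [folklore] -/
theorem sum_cbit (hk : 1 ≤ k) (htot : ∑ w, dm w = 0) (w : Fin (k + 1) × Fin (k + 1)) :
    ∑ ε ∈ leftEdges w, cbit k dm ε + ∑ ε ∈ rightEdges w, cbit k dm ε = dm w := by
  rw [← rowPre_eq_sum] at htot
  obtain ⟨i, c⟩ := w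
  rw [sum_leftEdges, sum_rightEdges]
  dsimp only
  rw [add_add_add_comm, cbit_horizontal hk htot i.isLt c.isLt, cbit_vertical hk i.isLt c.isLt, demN,
    dif_pos ⟨i.isLt, c.isLt⟩]
  by_cases hik : (i : ℕ) = k
  · rw [if_pos hik, add_comm (dm _), ← add_assoc, CharTwo.add_self_eq_zero, zero_add]
  · rw [if_neg hik, zero_add, add_zero]

end TJoin

/-! ### The stars telescope to `κ` under a local bijection -/

section Stars

variable (k)

/-- The value in `𝔽₂` of the pigeon-star of the horizontal edge `(i,c)—(i,c+1)` under the pigeon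
map `fP`: `[c ≤ fP i < k]`. [folklore] -/
def starValH (fP : ℕ → ℕ) (i c : ℕ) : ZMod 2 := if c ≤ fP i ∧ fP i < k then 1 else 0

/-- The value in `𝔽₂` of the hole-star of the vertical edge `(i,c)—(i+1,c)` under the hole map
`gH`: `[c ≠ 0 ∧ i + 1 ≤ gH (c-1) < k + 1]`. [folklore] -/
def starValV (gH : ℕ → ℕ) (i c : ℕ) : ZMod 2 :=
  if c ≠ 0 ∧ (i + 1 ≤ gH (c - 1) ∧ gH (c - 1) < k + 1) then 1 else 0

/-- The star values of the edges. [folklore] -/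
def starVal (fP gH : ℕ → ℕ) : GridEdge k → ZMod 2
  | Sum.inl (i, c) => starValH k fP i c
  | Sum.inr (i, c) => starValV k gH i c

variable {k}

/-- The value of an edge is its constant bit plus its star value. [folklore] -/
theorem zv_val_eq (fP gH : ℕ → ℕ) (ε : GridEdge k) :
    zv (val (lab k f) fP gH (gi k ε)) = cbit k (dem k f) ε + starVal k fP gH ε := by
  rcases ε with ⟨i, c⟩ | ⟨i, c⟩
  · rw [zv_val_inl]; rfl
  · rw [zv_val_inr]; rfl

/-- **Pigeon walk**: the pigeon-stars of the horizontal edges at `(i, c)` telescope to `1` at the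
terminal `c = 0` and to `[fP i = c - 1]` elsewhere, when `fP i < k`. [cite: KrajicekProofComplexity2019, §15.4 (proof of Lemma 15.4.3)] -/
theorem star_horizontal (hk : 1 ≤ k) {fP gH : ℕ → ℕ} {i c : ℕ} (hi : i < k + 1) (hc : c < k + 1)
    (hf : fP i < k) :
    (if c = 0 then 0 else extH (starVal k fP gH) i (c - 1)) + extH (starVal k fP gH) i c =
      (if c = 0 then 1 else 0) + (if c ≠ 0 ∧ fP i = c - 1 then 1 else 0) := by
  unfold extH
  simp only [starVal, starValH]
  split_ifs <;> first | decide | (exfalso; omega)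

/-- **Hole walk**: the hole-stars of the vertical edges at `(i, c)`, `c ≠ 0`, telescope to
`[i = 0] + [gH (c-1) = i]`, when `gH (c-1) < k + 1`; in column `0` there are none. [cite: KrajicekProofComplexity2019, §15.4 (proof of Lemma 15.4.3)] -/
theorem star_vertical (hk : 1 ≤ k) {fP gH : ℕ → ℕ} {i c : ℕ} (hi : i < k + 1) (hc : c < k + 1)
    (hg : c ≠ 0 → gH (c - 1) < k + 1) :
    extV (starVal k fP gH) i c + (if i = 0 then 0 else extV (starVal k fP gH) (i - 1) c) =
      if c = 0 then 0 else ((if i = 0 then 1 else 0) + (if gH (c - 1) = i then 1 else 0)) := by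
  unfold extV
  simp only [starVal, starValV]
  by_cases hc0 : c = 0
  · subst hc0
    simp
  · have hg' := hg hc0
    split_ifs <;> first | decide | (exfalso; omega)

/-- **The stars telescope to `κ`**: under a local bijection consistent on the edges at `(i, c)`,
the star values of the incident edges sum to `κ(i, c) = [i = 0 ∨ c = 0]`. [cite: KrajicekProofComplexity2019, §15.4 (the substituted axioms follow from ¬ontoPHP_n)] -/
theorem sum_starVal (hk : 1 ≤ k) {fP gH : ℕ → ℕ} (w : Fin (k + 1) × Fin (k + 1))
    (hf : fP w.1 < k) (hg : (w.2 : ℕ) ≠ 0 → gH ((w.2 : ℕ) - 1) < k + 1)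
    (hiff : (w.2 : ℕ) ≠ 0 → (fP w.1 = (w.2 : ℕ) - 1 ↔ gH ((w.2 : ℕ) - 1) = w.1)) :
    ∑ ε ∈ leftEdges w, starVal k fP gH ε + ∑ ε ∈ rightEdges w, starVal k fP gH ε = kap k w := by
  obtain ⟨i, c⟩ := w
  rw [sum_leftEdges, sum_rightEdges]
  dsimp only at hf hg hiff ⊢
  rw [add_add_add_comm, star_horizontal hk i.isLt c.isLt hf, star_vertical hk i.isLt c.isLt hg, kap]
  dsimp only
  have hi0 : (i = 0) ↔ ((i : ℕ) = 0) := Fin.ext_iff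
  have hc0 : (c = 0) ↔ ((c : ℕ) = 0) := Fin.ext_iff
  simp only [hi0, hc0]
  by_cases hcz : (c : ℕ) = 0
  · simp [hcz]
  · have hiff' := hiff hcz
    rw [if_neg hcz, if_neg hcz, zero_add]
    by_cases hiz : (i : ℕ) = 0
    · rw [if_pos hiz, if_pos (Or.inl hiz)]
      by_cases hfe : fP i = (c : ℕ) - 1
      · rw [if_pos ⟨hcz, hfe⟩, if_pos (hiff'.1 hfe)]; decide
      · rw [if_neg (fun h => hfe h.2), if_neg (fun h => hfe (hiff'.2 h))]; decide
    · rw [if_neg hiz, if_neg (not_or_intro hiz hcz)]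
      by_cases hfe : fP i = (c : ℕ) - 1
      · rw [if_pos ⟨hcz, hfe⟩, if_pos (hiff'.1 hfe)]; decide
      · rw [if_neg (fun h => hfe h.2), if_neg (fun h => hfe (hiff'.2 h))]; decide

end Stars

/-! ### Soundness -/

/-- `Σ κ = 2k + 1 = 1` in `𝔽₂` (the pigeon terminals and the hole terminals). [folklore] -/
theorem sum_kap (k : ℕ) : ∑ w, kap k w = 1 := by
  rw [Fintype.sum_prod_type, Fin.sum_univ_succ]
  have h0 : ∑ c : Fin (k + 1), kap k (0, c) = (k + 1 : ℕ) := by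
    simp [kap]
  have h1 : ∀ j : Fin k, ∑ c : Fin (k + 1), kap k (j.succ, c) = 1 := fun j => by
    simp [kap, Fin.succ_ne_zero, Finset.sum_ite_eq']
  rw [h0, Finset.sum_congr rfl fun j _ => h1 j, Finset.sum_const, Finset.card_univ, Fintype.card_fin,
    nsmul_eq_mul, mul_one]
  have h2 : ((2 * k + 1 : ℕ) : ZMod 2) = 1 := by
    rw [Nat.cast_add, Nat.cast_mul, ZMod.natCast_self, zero_mul, zero_add, Nat.cast_one]
  rw [← h2]
  push_cast
  ring

/-- **The labelling is sound** when the total charge is odd (`k ≥ 1`): at every cell the incident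
values telescope to the charge under every local bijection consistent on the incident edges.
[cite: KrajicekProofComplexity2019, §15.4 (the substituted axioms are provable from ¬ontoPHP_n)] -/
theorem lab_sound (hk : 1 ≤ k) (hf : ∑ w, f w = 1) : PHPLabel.Sound (lab k f) k (gridSystem k f) := by
  intro r fP gH hcons
  obtain ⟨h1, h2, -, -, h5⟩ := hcons
  obtain ⟨w, rfl⟩ : ∃ w, r = Fintype.equivFin _ w := ⟨(Fintype.equivFin _).symm r, by simp⟩
  obtain ⟨i, c⟩ := w
  -- a horizontal edge at `(i, c)` labelled by pigeon `i`, a vertical one labelled by hole `c - 1`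
  obtain ⟨εh, hεh, ch, hch⟩ : ∃ ε : GridEdge k, ((gridEnds ε).1 = (i, c) ∨ (gridEnds ε).2 = (i, c)) ∧
      ∃ c' : ℕ, psOf k ε = some ((i : ℕ), Finset.Ico c' k) := by
    by_cases hck : (c : ℕ) < k
    · exact ⟨Sum.inl (i, ⟨c, hck⟩), Or.inr (by rw [gridEnds_inl]; ext <;> simp), c, rfl⟩
    · have hc1 : (c : ℕ) - 1 < k := by have := c.isLt; omega
      exact ⟨Sum.inl (i, ⟨(c : ℕ) - 1, hc1⟩), Or.inl (by rw [gridEnds_inl]; ext <;> simp; omega),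
        (c : ℕ) - 1, rfl⟩
  have hfP : fP i < k := h1 (gi k εh) (gi_mem_eqVars hεh) i (Finset.Ico ch k) (by rw [ps_gi, hch])
  have hvert : (c : ℕ) ≠ 0 → ∃ ε : GridEdge k, ((gridEnds ε).1 = (i, c) ∨ (gridEnds ε).2 = (i, c)) ∧
      ∃ i' : ℕ, hsOf k ε = some ((c : ℕ) - 1, Finset.Ico i' (k + 1)) := fun hc0 => by
    by_cases hik : (i : ℕ) < k
    · refine ⟨Sum.inr (⟨i, hik⟩, c), Or.inl (by rw [gridEnds_inr]; ext <;> simp), (i : ℕ) + 1, ?_⟩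
      rw [hsOf, if_neg hc0]
    · have hi1 : (i : ℕ) - 1 < k := by have := i.isLt; omega
      refine ⟨Sum.inr (⟨(i : ℕ) - 1, hi1⟩, c), Or.inr (by rw [gridEnds_inr]; ext <;> simp; omega),
        (i : ℕ) - 1 + 1, ?_⟩
      rw [hsOf, if_neg hc0]
  have hgH : (c : ℕ) ≠ 0 → gH ((c : ℕ) - 1) < k + 1 := fun hc0 => by
    obtain ⟨εv, hεv, iv, hiv⟩ := hvert hc0
    exact h2 (gi k εv) (gi_mem_eqVars hεv) _ (Finset.Ico iv (k + 1)) (by rw [hs_gi, hiv])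
  have hiff : (c : ℕ) ≠ 0 → (fP i = (c : ℕ) - 1 ↔ gH ((c : ℕ) - 1) = i) := fun hc0 => by
    obtain ⟨εv, hεv, iv, hiv⟩ := hvert hc0
    exact h5 (gi k εh) (gi_mem_eqVars hεh) (gi k εv) (gi_mem_eqVars hεv) i (Finset.Ico ch k) _
      (Finset.Ico iv (k + 1)) (by rw [ps_gi, hch]) (by rw [hs_gi, hiv])
  -- the equation of the cell
  show ∑ j, (gridSystem k f _).1 j * (if val (lab k f) fP gH j then 1 else 0) = (gridSystem k f _).2
  rw [rowSum_gridSystem, gridSystem_snd, Equiv.symm_apply_apply]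
  have hz : ∀ ε : GridEdge k,
      (if val (lab k f) fP gH ((Fintype.equivFin (GridEdge k) ε : ℕ)) then (1 : ZMod 2) else 0) =
        cbit k (dem k f) ε + starVal k fP gH ε := fun ε => zv_val_eq fP gH ε
  simp only [hz, Finset.sum_add_distrib]
  have htot : ∑ w, dem k f w = 0 := by
    simp only [dem, Finset.sum_add_distrib, hf, sum_kap]
    decide
  rw [add_add_add_comm, sum_cbit hk htot, sum_starVal hk (i, c) hfP hgH hiff, dem, add_assoc,
    CharTwo.add_self_eq_zero, add_zero]

/-! ### Unsatisfiability forces an odd total charge -/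

/-- **Even total charge is solvable**: if `Σ f = 0`, routing the charges solves the grid Tseitin
system; hence an unsolvable grid system has `Σ f = 1` (`k ≥ 1`). [cite: GalesiEtAl2023, §2 ("T(G, f) is unsatisfiable iff the sum of the charges of some component is odd")] -/
theorem sum_charge_eq_one_of_not_systemSat (hk : 1 ≤ k) (h : ¬ SystemSat (gridSystem k f) Finset.univ) :
    ∑ w, f w = 1 := by
  by_contra hne
  have h0 : ∑ w, f w = 0 := by
    generalize ∑ w, f w = x at hne ⊢
    fin_cases x
    · rfl
    · exact absurd rfl hne
  apply h
  refine ⟨fun j => cbit k f ((Fintype.equivFin (GridEdge k)).symm j), fun r _ => ?_⟩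
  obtain ⟨w, rfl⟩ : ∃ w, r = Fintype.equivFin _ w := ⟨(Fintype.equivFin _).symm r, by simp⟩
  show ∑ j, (gridSystem k f _).1 j * cbit k f ((Fintype.equivFin (GridEdge k)).symm j) = (gridSystem k f _).2
  rw [rowSum_gridSystem, gridSystem_snd, Equiv.symm_apply_apply]
  simp only [Equiv.symm_apply_apply]
  exact sum_cbit hk h0 w

end GridLabel

/-! ### The lower bound -/

open GridLabel in
/-- **Bounded-depth Frege lower bound for Tseitin formulas on grids, all charges** (Håstad 2020,
Thm. 6.2, with the weak exponent `ε_d`; here by Ben-Sasson's reduction to the bijective pigeonhole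
principle and Ajtai's theorem, fully proved): for every depth `d` there are `ε > 0` and `k₀` such
that for all `k ≥ k₀` and all charges `f`, every depth-`d` `textbookFrege`-proof of the negated
parity CNF of the grid Tseitin system `gridSystem k f` of `𝓗_{k,k}` has size at least `2^{k^ε}`.
(For even total charge the system is solvable and no such proof exists; for odd total charge the
labelling `GridLabel.lab` is sound.) [cite: Hastad2020, Thm. 6.2 (statement, with exponent Ω(1/d); here ε_d)]
[cite: BenSasson2002, Thm. 1.1 (method: reduction of Tseitin formulas to the pigeonhole principle)]
[cite: KrajicekProofComplexity2019, §15.4 and p. 431] -/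
theorem gridSystem_depthFrege_lowerBound (d : ℕ) :
    ∃ ε : ℝ, 0 < ε ∧ ∃ k₀ : ℕ, ∀ k ≥ k₀, ∀ (f : Fin (k + 1) × Fin (k + 1) → ZMod 2)
      (π : List (PropForm ℕ)),
      textbookFrege.IsDepthProofOf d π (neg (PropForm.ofCNF (sumEncoding 1 (gridSystem k f)))) →
        (2 : ℝ) ^ ((k : ℝ) ^ ε) ≤ (proofSize π : ℝ) := by
  obtain ⟨ε, hε, N₀, h⟩ := depthFrege_lowerBound_of_sound_label 4 d
  refine ⟨ε, hε, max N₀ 1, fun k hk f π hπ => ?_⟩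
  have hk1 : 1 ≤ k := le_of_max_le_right hk
  -- a proof of the negation exists, so the system is unsolvable and the total charge is odd
  have hunsat : ¬ SystemSat (gridSystem k f) Finset.univ := by
    intro hsat
    obtain ⟨σ, hσ⟩ := (sumEncoding_satisfiable_iff (p := 2) (B := 1) (by norm_num) one_pos
      (gridSystem k f)).2 hsat
    have htaut := isSound_textbookFrege.isTautology_of_isProofOf hπ.1 σ
    rw [PropForm.eval, eval_ofCNF, hσ] at htaut
    exact Bool.false_ne_true htaut
  exact h k (le_of_max_le_left hk) _ _ (gridSystem k f) card_supp_gridSystem_le (lab k f) lab_wf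
    (lab_sound hk1 (sum_charge_eq_one_of_not_systemSat hk1 hunsat)) π hπ

end Literature.Computability.MetaComplexity
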